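import Summits.ABC.StewartYu.PadicG3PackClosedHalf
import Literature.NumberTheory.Transcendental.SiegelStepCoefficients
import HarnessLib

/-!
# Cell abc-stewartyu, crux `Y07Odd` (stmt-ABC-19658), line `gen3-slab-odd`: SIZE BOUNDS of the closed forms `BwC`, `M0C`, `XbC`, `DC`, `MhC` in the
# record's currency (heights `h(αⱼ)`, coefficient logarithm `W`, `L₀`, `H`, box) — the bridge from the frame's closed forms to p1's budgets

`Summits/ABC/StewartYu/PadicG3ClosedLogs.lean` — cell `abc-stewartyu` (seat p2-g4, F-odd lead; for p1 g7/g8's `IneqPack` proofs).  Theorems only; no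
named fact.  `den_le_pow` (`den(ℓ,H) ≤ H^ℓ`), `BwC_le` (`BwC ≤ (L₀+1)·H^{L₀}·(p^m√p)^{L₀}`), `M0C_le` (`M0C ≤ expr + 1`) with
`lcmUpto_le_exp` (`ν(H) ≤ e^{(log 4+4)H}`), `abs_b_le_exp` (`|bⱼ| ≤ e^W`), `XbC_le` (`XbC ≤ 2·n·e^W·ΣLⱼ`), `log_monDen_boxExpG_le`
(`log monDen(α, L|x|) ≤ 2|x|·Σ Lⱼ h(αⱼ)`), `log_monDen_halfE_le`, `DC_le_real`.

References: Yu. V. Nesterenko, LNM 1819 (2003) §3.1–§3.4 (the sizes (3.8), (3.26), (3.48)).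
-/

noncomputable section

open Finset
open Literature.NumberTheory.Transcendental
open Literature.NumberTheory.Transcendental (FeldmanDelta.den)
open Literature.NumberTheory.Transcendental.FeldmanDelta
open Literature.NumberTheory.Transcendental.CW77.Setup (Tau tauNorm)
open scoped Nat

namespace Summit.ABC.StewartYu

namespace G3Setup

variable {p : ℕ} [Fact p.Prime] (S : G3Setup p)

/-- `den(ℓ, H) ≤ H^ℓ` for `H ≥ 1`. [folklore] -/
theorem den_le_pow (ℓ : ℕ) {H : ℕ} (hH : 1 ≤ H) : den ℓ H ≤ H ^ ℓ := by
  unfold FeldmanDelta.den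
  calc ∏ i ∈ range ℓ, (i % H + 1) ≤ ∏ _i ∈ range ℓ, H := prod_le_prod' fun i _ => Nat.mod_lt i (by omega)
    _ = H ^ ℓ := by rw [prod_const, card_range]

omit [Fact p.Prime] in
/-- **`BwC ≤ (L₀+1)·H^{L₀}·(p^m √p)^{L₀}`.** [cite: Nesterenko2003, (3.8); shape only] -/
theorem BwC_le (L₀ : ℕ) {H : ℕ} (hH : 1 ≤ H) (m : ℕ) :
    BwC (p := p) L₀ H m ≤ ((L₀ : ℝ) + 1) * (H : ℝ) ^ L₀ * ((p : ℝ) ^ m * Real.sqrt p) ^ L₀ := by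
  unfold BwC
  refine mul_le_mul_of_nonneg_right ?_ (by positivity)
  have h1 : ∀ ℓ ∈ range (L₀ + 1), (den ℓ H : ℝ) ≤ (H : ℝ) ^ L₀ := by
    intro ℓ hℓ
    have hℓ' : ℓ ≤ L₀ := by rw [mem_range] at hℓ; omega
    calc (den ℓ H : ℝ) ≤ (H : ℝ) ^ ℓ := by exact_mod_cast den_le_pow ℓ hH
      _ ≤ (H : ℝ) ^ L₀ := pow_le_pow_right₀ (by exact_mod_cast hH) hℓ'
  calc ∑ ℓ ∈ range (L₀ + 1), (den ℓ H : ℝ) ≤ ∑ _ℓ ∈ range (L₀ + 1), (H : ℝ) ^ L₀ := sum_le_sum h1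
    _ = ((L₀ : ℝ) + 1) * (H : ℝ) ^ L₀ := by rw [sum_const, card_range, nsmul_eq_mul]; push_cast; ring

/-- **`M0C ≤ expr + 1`** with `ν(H) ≤ e^{(log 4 + 4)H}`:
`M0C(L₀,H,Ŝ,lev,x,t₀) ≤ 2^{(Ŝ−lev)t₀} · e^{(log 4+4)H t₀} · e^{H/e} · (e(1 + 2^{Ŝ−lev}|x|/H))^{L₀} + 1`. [cite: Nesterenko2003, (3.8); shape only] -/
theorem M0C_le (L₀ H Sh lev : ℕ) (x : ℤ) (t₀ : ℕ) :
    (M0C L₀ H Sh lev x t₀ : ℝ) ≤ (2 : ℝ) ^ ((Sh - lev) * t₀) * (Real.exp ((Real.log 4 + 4) * H * t₀) *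
      (Real.exp (H / Real.exp 1) * (Real.exp 1 * (1 + |((2 ^ (Sh - lev) * x : ℤ) : ℝ)| / H)) ^ L₀)) + 1 := by
  unfold M0C
  refine le_trans (le_of_lt (Int.ceil_lt_add_one _)) ?_
  refine add_le_add ?_ le_rfl
  refine mul_le_mul_of_nonneg_left (mul_le_mul_of_nonneg_right ?_ (by positivity)) (by positivity)
  calc (Nat.lcmUpto H : ℝ) ^ t₀ ≤ (Real.exp ((Real.log 4 + 4) * H)) ^ t₀ :=
        pow_le_pow_left₀ (by positivity) (CalegariDimitrovTang.lcmUpto_le_exp H) t₀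
    _ = Real.exp ((Real.log 4 + 4) * H * t₀) := by rw [← Real.exp_nat_mul]; congr 1; ring

/-- `|bⱼ| ≤ e^W` from `log max(3,|bⱼ|) ≤ W`. [folklore] -/
theorem abs_b_le_exp {W : ℝ} (hWb : ∀ j, Real.log (max 3 (|S.b j| : ℝ)) ≤ W) (j : Fin S.n) : (|S.b j| : ℝ) ≤ Real.exp W := by
  have h3 : (0 : ℝ) < max 3 (|S.b j| : ℝ) := lt_of_lt_of_le (by norm_num) (le_max_left _ _)
  calc (|S.b j| : ℝ) ≤ max 3 (|S.b j| : ℝ) := le_max_right _ _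
    _ = Real.exp (Real.log (max 3 (|S.b j| : ℝ))) := (Real.exp_log h3).symm
    _ ≤ Real.exp W := Real.exp_le_exp.mpr (hWb j)

/-- **`XbC L ≤ 2·n·e^W·Σ Lⱼ`.** [folklore] -/
theorem XbC_le {W : ℝ} (hWb : ∀ j, Real.log (max 3 (|S.b j| : ℝ)) ≤ W) (L : Fin S.n → ℕ) :
    (S.XbC L : ℝ) ≤ 2 * S.n * Real.exp W * ∑ j, (L j : ℝ) := by
  unfold XbC
  push_cast
  have hb : ∑ j, |((S.b j : ℤ) : ℝ)| ≤ S.n * Real.exp W := by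
    calc ∑ j, |((S.b j : ℤ) : ℝ)| ≤ ∑ _j : Fin S.n, Real.exp W := sum_le_sum fun j _ => S.abs_b_le_exp hWb j
      _ = S.n * Real.exp W := by rw [sum_const, card_univ, Fintype.card_fin, nsmul_eq_mul]
  have hL : (0 : ℝ) ≤ ∑ j, (L j : ℝ) := sum_nonneg fun j _ => by positivity
  calc (2 : ℝ) * ((∑ j, |((S.b j : ℤ) : ℝ)|) * ∑ j, (L j : ℝ)) ≤ 2 * ((S.n * Real.exp W) * ∑ j, (L j : ℝ)) := by
        gcongr
    _ = 2 * S.n * Real.exp W * ∑ j, (L j : ℝ) := by ring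

/-- **`log monDen(α, L·|x|) ≤ 2|x|·Σ Lⱼ h(αⱼ)`.** [cite: Nesterenko2003, §3.2; shape only] -/
theorem log_monDen_boxExpG_le (L : Fin S.n → ℕ) (x : ℤ) :
    Real.log (MonomialDen.monDen S.α (S.boxExpG L x) : ℝ) ≤ 2 * |(x : ℝ)| * ∑ j, (L j : ℝ) * Height.logHeight₁ (S.α j) := by
  have hsum : ∑ j, ((S.boxExpG L x j : ℕ) : ℝ) * Height.logHeight₁ (S.α j) = |(x : ℝ)| * ∑ j, (L j : ℝ) * Height.logHeight₁ (S.α j) := by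
    rw [Finset.mul_sum]
    refine sum_congr rfl fun j _ => ?_
    unfold boxExpG
    push_cast
    rw [Nat.cast_natAbs, Int.cast_abs]
    ring
  calc Real.log (MonomialDen.monDen S.α (S.boxExpG L x) : ℝ) ≤ 2 * ∑ j, ((S.boxExpG L x j : ℕ) : ℝ) * Height.logHeight₁ (S.α j) :=
        MonomialDen.log_monDen_le S.α S.α_ne _
    _ = 2 * |(x : ℝ)| * ∑ j, (L j : ℝ) * Height.logHeight₁ (S.α j) := by rw [hsum]; ring

/-- **`log monDen(α, 2L|s₁|) ≤ 4|s₁|·Σ Lⱼ h(αⱼ)`** (the half-step clearing box). [cite: Nesterenko2003, §3.2; shape only] -/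
theorem log_monDen_halfE_le (L : Fin S.n → ℕ) (s₁ : ℤ) :
    Real.log (MonomialDen.monDen S.α (S.halfE L s₁) : ℝ) ≤ 4 * |(s₁ : ℝ)| * ∑ j, (L j : ℝ) * Height.logHeight₁ (S.α j) := by
  have hsum : ∑ j, ((S.halfE L s₁ j : ℕ) : ℝ) * Height.logHeight₁ (S.α j) = 2 * |(s₁ : ℝ)| * ∑ j, (L j : ℝ) * Height.logHeight₁ (S.α j) := by
    rw [Finset.mul_sum]
    refine sum_congr rfl fun j _ => ?_
    unfold halfE
    push_cast
    rw [Nat.cast_natAbs, Int.cast_abs]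
    ring
  calc Real.log (MonomialDen.monDen S.α (S.halfE L s₁) : ℝ) ≤ 2 * ∑ j, ((S.halfE L s₁ j : ℕ) : ℝ) * Height.logHeight₁ (S.α j) :=
        MonomialDen.log_monDen_le S.α S.α_ne _
    _ = 4 * |(s₁ : ℝ)| * ∑ j, (L j : ℝ) * Height.logHeight₁ (S.α j) := by rw [hsum]; ring

/-- **`DC ≤ e^{(log 4+4)H t₀} · e^{W|t|} · monDen(α, 2L|s₁|)`** (real). [cite: Nesterenko2003, (3.26); shape only] -/
theorem DC_le_real {W : ℝ} (hWb : ∀ j, Real.log (max 3 (|S.b j| : ℝ)) ≤ W) (L : Fin S.n → ℕ) (H : ℕ) (s₁ : ℤ) (τ : Tau S.n) :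
    (S.DC L H s₁ τ : ℝ) ≤ Real.exp ((Real.log 4 + 4) * H * τ.1) * Real.exp (W * ∑ k, (τ.2 k : ℝ)) * (MonomialDen.monDen S.α (S.halfE L s₁) : ℝ) := by
  unfold DC
  push_cast
  refine mul_le_mul_of_nonneg_right (mul_le_mul ?_ ?_ (by positivity) (by positivity)) (by positivity)
  · calc (Nat.lcmUpto H : ℝ) ^ τ.1 ≤ (Real.exp ((Real.log 4 + 4) * H)) ^ τ.1 :=
          pow_le_pow_left₀ (by positivity) (CalegariDimitrovTang.lcmUpto_le_exp H) _
      _ = Real.exp ((Real.log 4 + 4) * H * τ.1) := by rw [← Real.exp_nat_mul]; congr 1; ring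
  · have hb : (((S.b S.j₀).natAbs : ℕ) : ℝ) ≤ Real.exp W := by
      rw [Nat.cast_natAbs, Int.cast_abs]; exact S.abs_b_le_exp hWb S.j₀
    calc (((S.b S.j₀).natAbs : ℕ) : ℝ) ^ (∑ k, τ.2 k) ≤ (Real.exp W) ^ (∑ k, τ.2 k) := pow_le_pow_left₀ (by positivity) hb _
      _ = Real.exp (W * ∑ k, (τ.2 k : ℝ)) := by rw [← Real.exp_nat_mul]; congr 1; push_cast; ring

end G3Setup

end Summit.ABC.StewartYu

end
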